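import Mathlib
import HarnessLib
import Literature.NumberTheory.LFunctions.ZetaScrew
import Summits.RiemannHypothesis.RiemannHypothesis.Theorems.IntegerScrewIncrementGram
import Summits.RiemannHypothesis.RiemannHypothesis.Theorems.IntegerScrewArithmeticBrackets

/-!
# Route `IntegerScrew` — ★ THE ARITHMETIC FLOOR OF THE PIVOT DEFICIT:
# `liminf_{S_{M−1} ≻ 0} G(M)·log M ≥ S_K + Σ_{q ∈ P} Λ(q)²/q²` for every `K` and every finite set `P`
# (PIVOT-LAW §15.14, kernel road (5); RH-FREE given `S_{M−1} ≻ 0`)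

`G(M) = M·(2Ψ(log(M/(M−1))) − d_M)` is the deficit of the pivot `d_M` below the variance of the newest
increment `I_M` of Kreĭn's screw line.  The trial vector
`I_M − (1/log M)·Σ_{k ≤ K} (c_k/2)·I_{M−k} + (1/log M)·Σ_{q ∈ P} (Λ(q)/(q√q))·I_{⌈M/q⌉}`
in the variational characterisation of `d_M` (`IntegerScrewIncrementGram.screwPivot_le_incrementGram`),
together with the Gram asymptotics of `IntegerScrewArithmeticBrackets` (rows `c_k/2` and `−Λ(q)/√q`,
diagonals `log M` and `q·log M`, all cross terms `O(1)`) and the abstract floor lemma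
`IntegerScrewIncrementGram.eventually_gramFloor`, gives

* ★ `eventually_arithmetic_deficit_floor K P` : for every `ε > 0`, eventually in `M`,
  `S_{M−1} ≻ 0 → S_K + Σ_{q ∈ P} Λ(q)²/q² − ε ≤ G(M)·log M`,
  `S_K = Σ_{k=1}^{K} (c_k/2)²`, `c_k/2 = −½Δ²[k log k]`;
* `eventually_kNode_deficit_floor'` : the case `P = ∅` — the `K`-node CONTINUUM floor `S_K` (PIVOT-LAW §15.3,
  §15.7) for every `K`, now independent of the contiguous Abel summation;
* `eventually_arithmetic_deficit_floor_of_riemannHypothesis` : under RH the proviso `S_{M−1} ≻ 0` is automatic.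

With `K → ∞` and `P ↑ {prime powers}` the floors increase to `V/2 + H₂ = 0.6493591 + 0.80521 = 1.45457`
(PIVOT-LAW §15.14: the Szegő continuum constant plus the prime-power hinge sum `Σ_q Λ(q)²/q²`).  Lower
bounds on `G` point AWAY from RH (`G < L ⇔` RH is an upper statement); nothing here bears on the truth of
RH. [Suzuki2023, (1.1), (1.4)]
-/

noncomputable section

-- D-0017: `Summit.<S>.<S>.…` is the designed namespace of a single-problem summit.
set_option linter.dupNamespace false

namespace Summit.RiemannHypothesis.RiemannHypothesis.Theorems.IntegerScrew

open Literature.NumberTheory.LFunctions Filter Finset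
open scoped Topology

/-- `Σ_{k < K+1} f(k) = f(0) + Σ_{k ∈ [1,K]} f(k)`. [folklore] -/
private theorem sum_range_succ_eq_add_sum_Icc (K : ℕ) (f : ℕ → ℝ) :
    ∑ k ∈ Finset.range (K + 1), f k = f 0 + ∑ k ∈ Finset.Icc 1 K, f k := by
  induction K with
  | zero => simp
  | succ K ih => rw [Finset.sum_range_succ, ih, Finset.sum_Icc_succ_top (by omega), add_assoc]

/-- `c_0/2 = 0` (the lag-coefficient expression vanishes at `k = 0`). [folklore] -/
private theorem lagCoeff_zero :
    (-((((0 : ℕ) : ℝ) + 1) * Real.log (((0 : ℕ) : ℝ) + 1) - 2 * ((((0 : ℕ) : ℝ)) * Real.log ((0 : ℕ) : ℝ))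
      + ((((0 : ℕ) : ℝ)) - 1) * Real.log ((((0 : ℕ) : ℝ)) - 1)) / 2 : ℝ) = 0 := by
  simp [Real.log_neg_eq_log]

/-- **★ THE ARITHMETIC FLOOR OF THE PIVOT DEFICIT** (PIVOT-LAW §15.14).  For every `K : ℕ`, every finite
set `P` of integers `≥ 2` and every `ε > 0`, eventually in `M`:
`S_{M−1} ≻ 0 → Σ_{k=1}^{K}(c_k/2)² + Σ_{q ∈ P} Λ(q)²/q² − ε ≤ M·(2Ψ(log(M/(M−1))) − d_M)·log M`
(`c_k/2 = −½((k+1)log(k+1) − 2k log k + (k−1)log(k−1))`; `Λ(q) = 0` unless `q` is a prime power).  The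
neighbour directions and the hinge carriers are orthogonal to leading order, so their gains add:
`(c_k/2)²/log M` each (`IntegerScrewIncrementCovLag`) and `Λ(q)²/(q² log M)` each
(`IntegerScrewHingeBrackets`). [folklore] -/
theorem eventually_arithmetic_deficit_floor (K : ℕ) (P : Finset ℕ) (hP : ∀ n ∈ P, 2 ≤ n)
    (ε : ℝ) (hε : 0 < ε) :
    ∀ᶠ M : ℕ in atTop, (screwMatrix (M - 2)).PosDef →
      (∑ k ∈ Finset.Icc 1 K, (-(((k : ℝ) + 1) * Real.log ((k : ℝ) + 1) - 2 * ((k : ℝ) * Real.log k)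
            + ((k : ℝ) - 1) * Real.log ((k : ℝ) - 1)) / 2) ^ 2)
        + (∑ n ∈ P, (ArithmeticFunction.vonMangoldt n) ^ 2 / (n : ℝ) ^ 2) - ε ≤
        (M : ℝ) * (2 * zetaScrew (Real.log ((M : ℝ) / ((M : ℝ) - 1))) - screwPivot M)
          * Real.log (M : ℝ) := by
  classical
  -- the index set: lags 0..K (corner = lag 0) and the carriers of P
  set s : Finset (ℕ ⊕ ℕ) := (Finset.range (K + 1)).disjSum P with hs
  set i₀ : ℕ ⊕ ℕ := Sum.inl 0 with hi₀def
  have hi₀ : i₀ ∈ s := Finset.inl_mem_disjSum.2 (Finset.mem_range.2 (Nat.succ_pos K))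
  -- labels, limits, weights
  set lab : ℕ → ℕ ⊕ ℕ → ℕ := fun M => Sum.elim (fun k => M - k) (fun n => (M + n - 1) / n) with hlab
  set C : ℕ ⊕ ℕ → ℝ := Sum.elim
    (fun k : ℕ => -(((k : ℝ) + 1) * Real.log ((k : ℝ) + 1) - 2 * ((k : ℝ) * Real.log k)
      + ((k : ℝ) - 1) * Real.log ((k : ℝ) - 1)) / 2)
    (fun n : ℕ => -(ArithmeticFunction.vonMangoldt n / Real.sqrt n)) with hC
  set w : ℕ ⊕ ℕ → ℝ := Sum.elim (fun _ : ℕ => (1 : ℝ)) (fun n : ℕ => (n : ℝ)) with hw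
  set L : ℕ → ℝ := fun M => Real.log (M : ℝ) with hL
  -- the scaled Gram entries M·B(lab i, lab j)
  set g : ℕ → (ℕ ⊕ ℕ) → (ℕ ⊕ ℕ) → ℝ := fun M i j => (M : ℝ) *
    (zetaScrew (Real.log (lab M i : ℝ) - Real.log ((lab M j : ℝ) - 1))
      + zetaScrew (Real.log ((lab M i : ℝ) - 1) - Real.log (lab M j : ℝ))
      - zetaScrew (Real.log (lab M i : ℝ) - Real.log (lab M j : ℝ))
      - zetaScrew (Real.log ((lab M i : ℝ) - 1) - Real.log ((lab M j : ℝ) - 1))) with hg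
  -- membership in s
  have hmem : ∀ i ∈ s, (∃ k, i = Sum.inl k ∧ k < K + 1) ∨ (∃ n, i = Sum.inr n ∧ n ∈ P) := by
    intro i hi
    rcases i with k | n
    · exact Or.inl ⟨k, rfl, Finset.mem_range.1 (Finset.inl_mem_disjSum.1 hi)⟩
    · exact Or.inr ⟨n, rfl, Finset.inr_mem_disjSum.1 hi⟩
  -- the hypotheses of the abstract floor lemma
  have hLT : Tendsto L atTop atTop := Real.tendsto_log_atTop.comp tendsto_natCast_atTop_atTop
  have hsymm : ∀ M, ∀ i ∈ s, ∀ j ∈ s, g M i j = g M j i := by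
    intro M i _ j _
    simp only [hg]
    rw [bracket_symm]
  have hrow : ∀ i ∈ s, i ≠ i₀ → Tendsto (fun M => g M i₀ i) atTop (𝓝 (C i)) := by
    intro i hi hne
    rcases hmem i hi with ⟨k, rfl, hk⟩ | ⟨n, rfl, hn⟩
    · have hk1 : 1 ≤ k := by
        rcases Nat.eq_zero_or_pos k with h | h
        · exact absurd (by rw [h]) hne
        · exact h
      simp only [hg, hlab, hC, hi₀def, Sum.elim_inl, Nat.sub_zero]
      exact tendsto_cornerBracket_lag k hk1
    · simp only [hg, hlab, hC, hi₀def, Sum.elim_inl, Sum.elim_inr, Nat.sub_zero]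
      exact tendsto_cornerBracket_ceil (hP n hn)
  have hdiag : ∀ i ∈ s, i ≠ i₀ → Tendsto (fun M => g M i i / L M) atTop (𝓝 (w i)) := by
    intro i hi _
    rcases hmem i hi with ⟨k, rfl, hk⟩ | ⟨n, rfl, hn⟩
    · simp only [hg, hlab, hw, hL, Sum.elim_inl]
      exact tendsto_lagBracket_self_div_log k
    · simp only [hg, hlab, hw, hL, Sum.elim_inr]
      exact tendsto_ceilBracket_self_div_log (hP n hn)
  have hwpos : ∀ i ∈ s, i ≠ i₀ → 0 < w i := by
    intro i hi _
    rcases hmem i hi with ⟨k, rfl, hk⟩ | ⟨n, rfl, hn⟩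
    · simp only [hw, Sum.elim_inl]; exact one_pos
    · simp only [hw, Sum.elim_inr]
      exact_mod_cast (by have := hP n hn; omega : 0 < n)
  have hoff : ∀ i ∈ s, ∀ j ∈ s, i ≠ i₀ → j ≠ i₀ → i ≠ j →
      ∃ B : ℝ, ∀ᶠ M in atTop, |g M i j| ≤ B := by
    intro i hi j hj _ _ hij
    rcases hmem i hi with ⟨k, rfl, hk⟩ | ⟨n, rfl, hn⟩
    · rcases hmem j hj with ⟨k', rfl, hk'⟩ | ⟨n', rfl, hn'⟩
      · have hkk : k ≠ k' := fun h => hij (by rw [h])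
        simp only [hg, hlab, Sum.elim_inl]
        exact eventually_abs_lagBracket_le hkk
      · simp only [hg, hlab, Sum.elim_inl, Sum.elim_inr]
        exact eventually_abs_lagCeilBracket_le k (hP n' hn')
    · rcases hmem j hj with ⟨k', rfl, hk'⟩ | ⟨n', rfl, hn'⟩
      · obtain ⟨B, hB⟩ := eventually_abs_lagCeilBracket_le k' (hP n hn)
        refine ⟨B, ?_⟩
        filter_upwards [hB] with M hM
        simp only [hg, hlab, Sum.elim_inl, Sum.elim_inr]
        rw [bracket_symm]
        exact hM
      · have hnn : n ≠ n' := fun h => hij (by rw [h])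
        simp only [hg, hlab, Sum.elim_inr]
        exact eventually_abs_ceilCeilBracket_le (hP n hn) (hP n' hn') hnn
  have hfloor := eventually_gramFloor s hi₀ g L C w hLT hsymm hrow hdiag hwpos hoff hε
  -- the value of the floor
  have hval : ∑ i ∈ s.erase i₀, C i ^ 2 / w i
      = (∑ k ∈ Finset.Icc 1 K, (-(((k : ℝ) + 1) * Real.log ((k : ℝ) + 1) - 2 * ((k : ℝ) * Real.log k)
            + ((k : ℝ) - 1) * Real.log ((k : ℝ) - 1)) / 2) ^ 2)
        + ∑ n ∈ P, (ArithmeticFunction.vonMangoldt n) ^ 2 / (n : ℝ) ^ 2 := by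
    rw [Finset.sum_erase_eq_sub hi₀, hs, Finset.sum_disjSum]
    simp only [hC, hw, hi₀def, Sum.elim_inl, Sum.elim_inr, div_one]
    rw [sum_range_succ_eq_add_sum_Icc, lagCoeff_zero]
    have hP' : ∑ n ∈ P, (-(ArithmeticFunction.vonMangoldt n / Real.sqrt n)) ^ 2 / (n : ℝ)
        = ∑ n ∈ P, (ArithmeticFunction.vonMangoldt n) ^ 2 / (n : ℝ) ^ 2 := by
      refine Finset.sum_congr rfl fun n hn => ?_
      have hn0 : (0 : ℝ) < n := by exact_mod_cast (by have := hP n hn; omega : 0 < n)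
      rw [neg_sq, div_pow, Real.sq_sqrt hn0.le]
      field_simp
    rw [hP']
    ring
  rw [hval] at hfloor
  -- eventual size conditions on the labels
  have hPb : ∀ᶠ M : ℕ in atTop, ∀ n ∈ P, 3 ≤ (M + n - 1) / n ∧ (M + n - 1) / n + 2 ≤ M :=
    (eventually_all_finset P).2 fun n hn => eventually_ceilDiv_bounds (hP n hn)
  filter_upwards [hfloor, hPb, eventually_ge_atTop (K + 3)] with M hfl hPM hMK hPD
  -- the trial inequality for this family
  have hlab₀ : lab M i₀ = M := by simp [hlab, hi₀def]
  have hθ₀ : (fun i : ℕ ⊕ ℕ => if i = i₀ then (1 : ℝ) else -(C i / w i) / L M) i₀ = 1 := by simp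
  have hlt : ∀ i ∈ s, i ≠ i₀ → lab M i < M := by
    intro i hi hne
    rcases hmem i hi with ⟨k, rfl, hk⟩ | ⟨n, rfl, hn⟩
    · have hk1 : 1 ≤ k := by
        rcases Nat.eq_zero_or_pos k with h | h
        · exact absurd (by rw [h]) hne
        · exact h
      simp only [hlab, Sum.elim_inl]; omega
    · simp only [hlab, Sum.elim_inr]; have := (hPM n hn).2; omega
  have h3 : ∀ i ∈ s, 3 ≤ lab M i := by
    intro i hi
    rcases hmem i hi with ⟨k, rfl, hk⟩ | ⟨n, rfl, hn⟩
    · simp only [hlab, Sum.elim_inl]; omega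
    · simp only [hlab, Sum.elim_inr]; exact (hPM n hn).1
  have htrial := screwPivot_le_incrementGram s (lab M)
    (fun i : ℕ ⊕ ℕ => if i = i₀ then (1 : ℝ) else -(C i / w i) / L M) hi₀ hlab₀ hθ₀ hlt h3 hPD
  -- bookkeeping: g = M·B, the corner entry, positivity
  have hM3 : (3 : ℝ) ≤ (M : ℝ) := by exact_mod_cast (by omega : 3 ≤ M)
  have hM0 : (0 : ℝ) ≤ (M : ℝ) := by linarith
  have hL0 : 0 ≤ L M := by simp only [hL]; exact Real.log_nonneg (by linarith)
  have hcorner : g M i₀ i₀ = (M : ℝ) * (2 * zetaScrew (Real.log ((M : ℝ) / ((M : ℝ) - 1)))) := by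
    simp only [hg, hlab₀]
    rw [bracket_self, Real.log_div (by linarith : (M : ℝ) ≠ 0) (by linarith : (M : ℝ) - 1 ≠ 0)]
  have hQ : ∑ i ∈ s, ∑ j ∈ s,
      (if i = i₀ then (1 : ℝ) else -(C i / w i) / L M) * (if j = i₀ then (1 : ℝ) else -(C j / w j) / L M)
        * g M i j
      = (M : ℝ) * ∑ i ∈ s, ∑ j ∈ s,
      (if i = i₀ then (1 : ℝ) else -(C i / w i) / L M) * (if j = i₀ then (1 : ℝ) else -(C j / w j) / L M)
        * (zetaScrew (Real.log (lab M i : ℝ) - Real.log ((lab M j : ℝ) - 1))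
          + zetaScrew (Real.log ((lab M i : ℝ) - 1) - Real.log (lab M j : ℝ))
          - zetaScrew (Real.log (lab M i : ℝ) - Real.log (lab M j : ℝ))
          - zetaScrew (Real.log ((lab M i : ℝ) - 1) - Real.log ((lab M j : ℝ) - 1))) := by
    rw [Finset.mul_sum]
    refine Finset.sum_congr rfl fun i _ => ?_
    rw [Finset.mul_sum]
    refine Finset.sum_congr rfl fun j _ => ?_
    simp only [hg]
    ring
  rw [hcorner, hQ, ← mul_sub] at hfl
  -- G·log M ≥ M·(2Ψ(h_M) − Q)·log M ≥ floor − ε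
  refine hfl.trans ?_
  simp only [hL]
  refine mul_le_mul_of_nonneg_right (mul_le_mul_of_nonneg_left ?_ hM0) hL0
  linarith [htrial]

/-- **The `K`-node CONTINUUM FLOOR** (PIVOT-LAW §15.3/§15.7; the case `P = ∅`): for every `K` and `ε > 0`,
eventually in `M`, `S_{M−1} ≻ 0 → S_K − ε ≤ G(M)·log M` — hence `liminf G·log M ≥ S_K ↑ V/2 = 0.6493591`.
[folklore] -/
theorem eventually_kNode_deficit_floor' (K : ℕ) (ε : ℝ) (hε : 0 < ε) :
    ∀ᶠ M : ℕ in atTop, (screwMatrix (M - 2)).PosDef →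
      (∑ k ∈ Finset.Icc 1 K, (-(((k : ℝ) + 1) * Real.log ((k : ℝ) + 1) - 2 * ((k : ℝ) * Real.log k)
            + ((k : ℝ) - 1) * Real.log ((k : ℝ) - 1)) / 2) ^ 2) - ε ≤
        (M : ℝ) * (2 * zetaScrew (Real.log ((M : ℝ) / ((M : ℝ) - 1))) - screwPivot M)
          * Real.log (M : ℝ) := by
  have h := eventually_arithmetic_deficit_floor K ∅ (fun n hn => absurd hn (Finset.notMem_empty n)) ε hε
  simpa only [Finset.sum_empty, add_zero] using h

/-- Under RH the proviso `S_{M−1} ≻ 0` holds for every `M` (`screwMatrix_posDef_of_riemannHypothesis`),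
so the arithmetic floor is unconditional along all `M`. [folklore] -/
theorem eventually_arithmetic_deficit_floor_of_riemannHypothesis (hRH : _root_.RiemannHypothesis)
    (K : ℕ) (P : Finset ℕ) (hP : ∀ n ∈ P, 2 ≤ n) (ε : ℝ) (hε : 0 < ε) :
    ∀ᶠ M : ℕ in atTop,
      (∑ k ∈ Finset.Icc 1 K, (-(((k : ℝ) + 1) * Real.log ((k : ℝ) + 1) - 2 * ((k : ℝ) * Real.log k)
            + ((k : ℝ) - 1) * Real.log ((k : ℝ) - 1)) / 2) ^ 2)
        + (∑ n ∈ P, (ArithmeticFunction.vonMangoldt n) ^ 2 / (n : ℝ) ^ 2) - ε ≤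
        (M : ℝ) * (2 * zetaScrew (Real.log ((M : ℝ) / ((M : ℝ) - 1))) - screwPivot M)
          * Real.log (M : ℝ) :=
  (eventually_arithmetic_deficit_floor K P hP ε hε).mono fun M hM =>
    hM (screwMatrix_posDef_of_riemannHypothesis hRH (M - 2))

end Summit.RiemannHypothesis.RiemannHypothesis.Theorems.IntegerScrew

end
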